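import Literature.MathematicalPhysics.KineticTheory.HardSphereCrossSection
import Mathlib.Analysis.SpecialFunctions.Gaussian.FourierTransform
import Mathlib.Analysis.InnerProductSpace.Projection.Reflection
import HarnessLib

/-!
# Gaussian moment tools on `ℝ³` for the Enskog collisional-stress tensor identity (part A)

Helper for the line `Sketch` of the crux `InformationPercolationEngine.ChaosClosesEuler`
(stmt-AtomisticToContinuum-15141), waypoint `CollisionalPressureValueInBand` of `stub_fluxClosure`.  Part A of the
proof of `∫_{S²} (g·ω)₊² ω_k ω_l dω = (2π/15)(|g|² δ_{kl} + 2 g_k g_l)` (part B: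
`InformationPercolationEngineChaosClosesEulerEnskogTensor.lean`): one-dimensional Gaussian moments through Mathlib's
Gamma integral, coordinate Gaussian integrals on `ℝ³` by Fubini (`EuclideanSpace.volume_preserving_symm_measurableEquiv_toLp`,
the method of `HardSphereCrossSection.lean`), integrability of quartic polynomials against `e^{-|x|²/2}`, invariance of
Gaussian integrals under linear isometries, and Householder reflections (`Submodule.reflection_sub`) sending an
orthonormal pair to `(e₀, e₁)`.

## References
* S. Chapman, T. G. Cowling, *The Mathematical Theory of Non-uniform Gases*, 3rd ed. (1970), §16.4.
* C. Cercignani, R. Illner, M. Pulvirenti, *The Mathematical Theory of Dilute Gases* (1994), §3.1.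
-/

noncomputable section

namespace Summit.AtomisticToContinuum.HydrodynamicLimit.Theorems.ChaosClosesEulerEnskogTensor

open MeasureTheory Real Set Metric
open scoped InnerProductSpace ENNReal BigOperators
open Literature.MathematicalPhysics.KineticTheory

/-! ## §1 One-dimensional Gaussian moments -/

/-- Even moments reduce to the half-line: `∫_ℝ |t|^{n} e^{-t²/2} dt = 2 ∫₀^∞ r^n e^{-r²/2} dr`. [folklore] -/
theorem integral_abs_pow_mul_exp (n : ℕ) :
    ∫ t : ℝ, |t| ^ n * rexp (-t ^ 2 / 2) = 2 * ∫ r in Ioi (0 : ℝ), r ^ n * rexp (-r ^ 2 / 2) := by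
  have h := integral_comp_abs (f := fun r : ℝ => r ^ n * rexp (-r ^ 2 / 2))
  simp only [sq_abs] at h
  rw [← h]

/-- `(1/2)^{-q} = 2^{q}` for real exponents. [folklore] -/
theorem half_rpow_neg (q : ℝ) : (1 / 2 : ℝ) ^ (-q) = 2 ^ q := by
  rw [one_div, Real.inv_rpow (by norm_num), Real.rpow_neg (by norm_num), inv_inv]

/-- `2^{n + 1/2} = 2^n √2`. [folklore] -/
theorem two_rpow_nat_add_half (n : ℕ) : (2 : ℝ) ^ ((n : ℝ) + 1 / 2) = 2 ^ n * √2 := by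
  rw [Real.rpow_add (by norm_num), Real.rpow_natCast, Real.sqrt_eq_rpow]

/-- `√2 · √π = √(2π)`. [folklore] -/
theorem sqrt_two_mul_sqrt_pi : √2 * √π = √(2 * π) := by
  rw [← Real.sqrt_mul (by norm_num : (0:ℝ) ≤ 2)]

/-- `∫₀^∞ r² e^{-r²/2} dr = √(2π)/2` (`Γ(3/2) = √π/2`). [folklore] -/
theorem integral_Ioi_pow_two_mul_exp :
    ∫ r in Ioi (0 : ℝ), r ^ 2 * rexp (-r ^ 2 / 2) = √(2 * π) / 2 := by
  have h := integral_rpow_mul_exp_neg_mul_rpow (p := 2) (q := 2) (b := 1 / 2) two_pos (by norm_num)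
    (by norm_num)
  have hl : ∫ x in Ioi (0 : ℝ), x ^ (2 : ℝ) * rexp (-(1 / 2) * x ^ (2 : ℝ)) =
      ∫ r in Ioi (0 : ℝ), r ^ 2 * rexp (-r ^ 2 / 2) := by
    refine setIntegral_congr_fun measurableSet_Ioi fun x _ => ?_
    rw [Real.rpow_two]
    ring_nf
  have hG : Real.Gamma ((2 + 1) / 2) = √π / 2 := by
    have := Real.Gamma_nat_add_half 1
    rw [show ((1 : ℕ) : ℝ) + 1 / 2 = (2 + 1) / 2 by norm_num] at this
    rw [this]; norm_num [Nat.doubleFactorial]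
  have hp : (1 / 2 : ℝ) ^ (-(2 + 1) / 2 : ℝ) = 2 * √2 := by
    rw [show (-(2 + 1) / 2 : ℝ) = -(((1 : ℕ) : ℝ) + 1 / 2) by norm_num, half_rpow_neg,
      two_rpow_nat_add_half, pow_one]
  rw [← hl, h, hG, hp, ← sqrt_two_mul_sqrt_pi]
  ring

/-- `∫₀^∞ r⁴ e^{-r²/2} dr = 3√(2π)/2` (`Γ(5/2) = 3√π/4`). [folklore] -/
theorem integral_Ioi_pow_four_mul_exp :
    ∫ r in Ioi (0 : ℝ), r ^ 4 * rexp (-r ^ 2 / 2) = 3 * √(2 * π) / 2 := by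
  have h := integral_rpow_mul_exp_neg_mul_rpow (p := 2) (q := 4) (b := 1 / 2) two_pos (by norm_num)
    (by norm_num)
  have hl : ∫ x in Ioi (0 : ℝ), x ^ (4 : ℝ) * rexp (-(1 / 2) * x ^ (2 : ℝ)) =
      ∫ r in Ioi (0 : ℝ), r ^ 4 * rexp (-r ^ 2 / 2) := by
    refine setIntegral_congr_fun measurableSet_Ioi fun x _ => ?_
    rw [show (4 : ℝ) = ((4 : ℕ) : ℝ) by norm_num, Real.rpow_natCast, Real.rpow_two]
    ring_nf
  have hG : Real.Gamma ((4 + 1) / 2) = 3 * √π / 4 := by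
    have := Real.Gamma_nat_add_half 2
    rw [show ((2 : ℕ) : ℝ) + 1 / 2 = (4 + 1) / 2 by norm_num] at this
    rw [this]; norm_num [Nat.doubleFactorial]
  have hp : (1 / 2 : ℝ) ^ (-(4 + 1) / 2 : ℝ) = 4 * √2 := by
    rw [show (-(4 + 1) / 2 : ℝ) = -(((2 : ℕ) : ℝ) + 1 / 2) by norm_num, half_rpow_neg,
      two_rpow_nat_add_half]
    norm_num
  rw [← hl, h, hG, hp, ← sqrt_two_mul_sqrt_pi]
  ring

/-- `∫₀^∞ r⁶ e^{-r²/2} dr = 15√(2π)/2` (`Γ(7/2) = 15√π/8`). [folklore] -/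
theorem integral_Ioi_pow_six_mul_exp :
    ∫ r in Ioi (0 : ℝ), r ^ 6 * rexp (-r ^ 2 / 2) = 15 * √(2 * π) / 2 := by
  have h := integral_rpow_mul_exp_neg_mul_rpow (p := 2) (q := 6) (b := 1 / 2) two_pos (by norm_num)
    (by norm_num)
  have hl : ∫ x in Ioi (0 : ℝ), x ^ (6 : ℝ) * rexp (-(1 / 2) * x ^ (2 : ℝ)) =
      ∫ r in Ioi (0 : ℝ), r ^ 6 * rexp (-r ^ 2 / 2) := by
    refine setIntegral_congr_fun measurableSet_Ioi fun x _ => ?_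
    rw [show (6 : ℝ) = ((6 : ℕ) : ℝ) by norm_num, Real.rpow_natCast, Real.rpow_two]
    ring_nf
  have hG : Real.Gamma ((6 + 1) / 2) = 15 * √π / 8 := by
    have := Real.Gamma_nat_add_half 3
    rw [show ((3 : ℕ) : ℝ) + 1 / 2 = (6 + 1) / 2 by norm_num] at this
    rw [this]; norm_num [Nat.doubleFactorial]
  have hp : (1 / 2 : ℝ) ^ (-(6 + 1) / 2 : ℝ) = 8 * √2 := by
    rw [show (-(6 + 1) / 2 : ℝ) = -(((3 : ℕ) : ℝ) + 1 / 2) by norm_num, half_rpow_neg,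
      two_rpow_nat_add_half]
    norm_num
  rw [← hl, h, hG, hp, ← sqrt_two_mul_sqrt_pi]
  ring

/-- `∫_ℝ t² e^{-t²/2} dt = √(2π)`. [folklore] -/
theorem integral_pow_two_mul_exp : ∫ t : ℝ, t ^ 2 * rexp (-t ^ 2 / 2) = √(2 * π) := by
  have h := integral_abs_pow_mul_exp 2
  simp only [sq_abs] at h
  rw [h, integral_Ioi_pow_two_mul_exp]; ring

/-- `∫_ℝ t⁴ e^{-t²/2} dt = 3√(2π)`. [folklore] -/
theorem integral_pow_four_mul_exp : ∫ t : ℝ, t ^ 4 * rexp (-t ^ 2 / 2) = 3 * √(2 * π) := by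
  have h := integral_abs_pow_mul_exp 4
  have habs : ∀ t : ℝ, |t| ^ 4 = t ^ 4 := fun t => by
    rw [show |t| ^ 4 = (|t| ^ 2) ^ 2 by ring, sq_abs]; ring
  simp only [habs] at h
  rw [h, integral_Ioi_pow_four_mul_exp]; ring

/-- Odd moments vanish: `∫_ℝ t e^{-t²/2} dt = 0`. [folklore] -/
theorem integral_pow_one_mul_exp : ∫ t : ℝ, t * rexp (-t ^ 2 / 2) = 0 := by
  have h := integral_neg_eq_self (fun t : ℝ => t * rexp (-t ^ 2 / 2)) volume
  simp only [neg_sq, neg_mul, integral_neg] at h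
  linarith

/-- Odd moments vanish: `∫_ℝ t³ e^{-t²/2} dt = 0`. [folklore] -/
theorem integral_pow_three_mul_exp : ∫ t : ℝ, t ^ 3 * rexp (-t ^ 2 / 2) = 0 := by
  have h := integral_neg_eq_self (fun t : ℝ => t ^ 3 * rexp (-t ^ 2 / 2)) volume
  simp only [neg_sq, integral_neg, show ∀ t : ℝ, (-t) ^ 3 = -(t ^ 3) from fun t => by ring,
    neg_mul] at h
  linarith

/-! ## §2 Coordinate Gaussian integrals on `ℝ³` -/

/-- The Gaussian weight `e^{-|x|²/2}` on `ℝ³` factorises over the coordinates. [folklore] -/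
theorem exp_neg_norm_sq_eq_prod (x : V3) :
    rexp (-‖x‖ ^ 2 / 2) = rexp (-x.ofLp 0 ^ 2 / 2) * rexp (-x.ofLp 1 ^ 2 / 2) * rexp (-x.ofLp 2 ^ 2 / 2) := by
  rw [EuclideanSpace.norm_sq_eq, Fin.sum_univ_three]
  simp only [Real.norm_eq_abs, sq_abs]
  rw [← Real.exp_add, ← Real.exp_add]
  congr 1
  ring

/-- A product of coordinate functions integrates to the product of the one-dimensional integrals
(`ℝ³ ≃ᵐ ℝ × ℝ × ℝ`, Fubini). [folklore] -/
theorem integral_coord_prod (h₀ h₁ h₂ : ℝ → ℝ) :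
    ∫ x : V3, h₀ (x.ofLp 0) * h₁ (x.ofLp 1) * h₂ (x.ofLp 2) =
      (∫ t, h₀ t) * (∫ t, h₁ t) * ∫ t, h₂ t := by
  have hmp := EuclideanSpace.volume_preserving_symm_measurableEquiv_toLp (Fin 3)
  set h : Fin 3 → ℝ → ℝ := ![h₀, h₁, h₂] with hh
  set g : (Fin 3 → ℝ) → ℝ := fun y => ∏ i, h i (y i) with hg
  have hfg : ∀ x : V3, h₀ (x.ofLp 0) * h₁ (x.ofLp 1) * h₂ (x.ofLp 2) =
      g ((MeasurableEquiv.toLp 2 (Fin 3 → ℝ)).symm x) := by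
    intro x
    simp only [hg, MeasurableEquiv.toLp_symm_apply, Fin.prod_univ_three, hh, Matrix.cons_val_zero,
      Matrix.cons_val_one, Matrix.cons_val_two, Matrix.tail_cons, Matrix.head_cons]
  simp_rw [hfg]
  rw [hmp.integral_comp' g]
  simp only [hg]
  rw [integral_fintype_prod_volume_eq_prod, Fin.prod_univ_three]
  simp only [hh, Matrix.cons_val_zero, Matrix.cons_val_one, Matrix.cons_val_two, Matrix.tail_cons,
    Matrix.head_cons]

/-- `∫_{ℝ³} x₀⁴ e^{-|x|²/2} dx = 3 (2π)^{3/2}`. [folklore] -/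
theorem integral_coord_pow_four :
    ∫ x : V3, x.ofLp 0 ^ 4 * rexp (-‖x‖ ^ 2 / 2) = 3 * √(2 * π) ^ 3 := by
  have h := integral_coord_prod (fun t => t ^ 4 * rexp (-t ^ 2 / 2)) (fun t => rexp (-t ^ 2 / 2))
    (fun t => rexp (-t ^ 2 / 2))
  rw [integral_pow_four_mul_exp, integral_exp_neg_sq_half] at h
  rw [← show (fun x : V3 => (x.ofLp 0 ^ 4 * rexp (-x.ofLp 0 ^ 2 / 2)) * rexp (-x.ofLp 1 ^ 2 / 2) *
      rexp (-x.ofLp 2 ^ 2 / 2)) = fun x : V3 => x.ofLp 0 ^ 4 * rexp (-‖x‖ ^ 2 / 2) by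
    funext x; rw [exp_neg_norm_sq_eq_prod]; ring]
  rw [h]; ring

/-- `∫_{ℝ³} x₀² x₁² e^{-|x|²/2} dx = (2π)^{3/2}`. [folklore] -/
theorem integral_coord_sq_sq :
    ∫ x : V3, x.ofLp 0 ^ 2 * x.ofLp 1 ^ 2 * rexp (-‖x‖ ^ 2 / 2) = √(2 * π) ^ 3 := by
  have h := integral_coord_prod (fun t => t ^ 2 * rexp (-t ^ 2 / 2)) (fun t => t ^ 2 * rexp (-t ^ 2 / 2))
    (fun t => rexp (-t ^ 2 / 2))
  rw [integral_pow_two_mul_exp, integral_exp_neg_sq_half] at h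
  rw [← show (fun x : V3 => (x.ofLp 0 ^ 2 * rexp (-x.ofLp 0 ^ 2 / 2)) *
      (x.ofLp 1 ^ 2 * rexp (-x.ofLp 1 ^ 2 / 2)) * rexp (-x.ofLp 2 ^ 2 / 2)) =
      fun x : V3 => x.ofLp 0 ^ 2 * x.ofLp 1 ^ 2 * rexp (-‖x‖ ^ 2 / 2) by
    funext x; rw [exp_neg_norm_sq_eq_prod]; ring]
  rw [h]; ring

/-- `∫_{ℝ³} x₀³ x₁ e^{-|x|²/2} dx = 0`. [folklore] -/
theorem integral_coord_cube_one :
    ∫ x : V3, x.ofLp 0 ^ 3 * x.ofLp 1 * rexp (-‖x‖ ^ 2 / 2) = 0 := by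
  have h := integral_coord_prod (fun t => t ^ 3 * rexp (-t ^ 2 / 2)) (fun t => t * rexp (-t ^ 2 / 2))
    (fun t => rexp (-t ^ 2 / 2))
  rw [integral_pow_three_mul_exp, integral_pow_one_mul_exp] at h
  rw [← show (fun x : V3 => (x.ofLp 0 ^ 3 * rexp (-x.ofLp 0 ^ 2 / 2)) *
      (x.ofLp 1 * rexp (-x.ofLp 1 ^ 2 / 2)) * rexp (-x.ofLp 2 ^ 2 / 2)) =
      fun x : V3 => x.ofLp 0 ^ 3 * x.ofLp 1 * rexp (-‖x‖ ^ 2 / 2) by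
    funext x; rw [exp_neg_norm_sq_eq_prod]; ring]
  rw [h]; ring

/-! ## §3 Integrability of polynomially weighted Gaussians on `ℝ³` -/

/-- The Gaussian `e^{-|x|²/4}` is integrable on `ℝ³`. [folklore] -/
theorem integrable_exp_neg_norm_sq_quarter : Integrable (fun x : V3 => rexp (-‖x‖ ^ 2 / 4)) := by
  have h := GaussianFourier.integrable_cexp_neg_mul_sq_norm_add (V := V3) (b := (1 / 4 : ℂ))
    (by norm_num) 0 0
  have h' := h.re
  refine h'.congr (Filter.Eventually.of_forall fun x => ?_)
  simp only [zero_mul, add_zero, RCLike.re_to_complex]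
  rw [show (-(1 / 4 : ℂ) * ((‖x‖ : ℂ)) ^ 2) = (((-‖x‖ ^ 2 / 4 : ℝ)) : ℂ) by push_cast; ring,
    Complex.exp_ofReal_re]

/-- `(1 + r⁴) e^{-r²/2} ≤ 33 e^{-r²/4}` (from `y²/2 ≤ e^{y}`). [folklore] -/
theorem one_add_pow_four_mul_exp_le (r : ℝ) :
    (1 + r ^ 4) * rexp (-r ^ 2 / 2) ≤ 33 * rexp (-r ^ 2 / 4) := by
  have hy : 0 ≤ r ^ 2 / 4 := by positivity
  have h1 : (r ^ 2 / 4) ^ 2 / 2 ≤ rexp (r ^ 2 / 4) := by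
    have := Real.pow_div_factorial_le_exp (r ^ 2 / 4) hy 2
    simpa [Nat.factorial] using this
  have h2 : (1 : ℝ) ≤ rexp (r ^ 2 / 4) := Real.one_le_exp hy
  have hsplit : rexp (-r ^ 2 / 2) = rexp (-r ^ 2 / 4) * (rexp (r ^ 2 / 4))⁻¹ := by
    rw [← Real.exp_neg, ← Real.exp_add]; congr 1; ring
  rw [hsplit]
  have hpos : 0 < rexp (r ^ 2 / 4) := Real.exp_pos _
  have hpos' : 0 < rexp (-r ^ 2 / 4) := Real.exp_pos _
  rw [show (1 + r ^ 4) * (rexp (-r ^ 2 / 4) * (rexp (r ^ 2 / 4))⁻¹) =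
      rexp (-r ^ 2 / 4) * ((1 + r ^ 4) / rexp (r ^ 2 / 4)) by rw [div_eq_mul_inv]; ring]
  rw [show 33 * rexp (-r ^ 2 / 4) = rexp (-r ^ 2 / 4) * 33 by ring]
  refine mul_le_mul_of_nonneg_left ?_ hpos'.le
  rw [div_le_iff₀ hpos]
  have h4 : r ^ 4 ≤ 32 * rexp (r ^ 2 / 4) := by nlinarith
  nlinarith

/-- A continuous function dominated by `C (1 + |x|⁴) e^{-|x|²/2}` is integrable on `ℝ³`. [folklore] -/
theorem integrable_of_le_poly_gaussian {f : V3 → ℝ} (hf : Continuous f) {C : ℝ}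
    (hle : ∀ x, |f x| ≤ C * ((1 + ‖x‖ ^ 4) * rexp (-‖x‖ ^ 2 / 2))) : Integrable f := by
  refine Integrable.mono' ((integrable_exp_neg_norm_sq_quarter.const_mul (C * 33)))
    hf.aestronglyMeasurable (Filter.Eventually.of_forall fun x => ?_)
  rw [Real.norm_eq_abs]
  refine (hle x).trans ?_
  have hC : 0 ≤ C := by
    have := (abs_nonneg (f 0)).trans (hle 0)
    have hp : 0 < (1 + ‖(0:V3)‖ ^ 4) * rexp (-‖(0:V3)‖ ^ 2 / 2) := by positivity
    nlinarith
  calc C * ((1 + ‖x‖ ^ 4) * rexp (-‖x‖ ^ 2 / 2)) ≤ C * (33 * rexp (-‖x‖ ^ 2 / 4)) :=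
        mul_le_mul_of_nonneg_left (one_add_pow_four_mul_exp_le ‖x‖) hC
    _ = C * 33 * rexp (-‖x‖ ^ 2 / 4) := by ring

/-! ## §4 Isometry invariance and Householder reductions -/

/-- Linear isometries preserve Gaussian integrals of functions of two projections:
`∫ F(⟪g,x⟫,⟪u,x⟫) e^{-|x|²/2} dx = ∫ F(⟪Sg,y⟫,⟪Su,y⟫) e^{-|y|²/2} dy`. [folklore] -/
theorem integral_comp_isometry (S : V3 ≃ₗᵢ[ℝ] V3) (F : ℝ → ℝ → ℝ) (g u : V3) :
    ∫ x : V3, F ⟪g, x⟫_ℝ ⟪u, x⟫_ℝ * rexp (-‖x‖ ^ 2 / 2) =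
      ∫ y : V3, F ⟪S g, y⟫_ℝ ⟪S u, y⟫_ℝ * rexp (-‖y‖ ^ 2 / 2) := by
  have h := S.measurePreserving.integral_comp S.toHomeomorph.measurableEmbedding
    (fun y : V3 => F ⟪S g, y⟫_ℝ ⟪S u, y⟫_ℝ * rexp (-‖y‖ ^ 2 / 2))
  rw [← h]
  refine integral_congr_ae (Filter.Eventually.of_forall fun x => ?_)
  simp only [LinearIsometryEquiv.norm_map, LinearIsometryEquiv.inner_map_map]

/-- The first standard basis vector of `ℝ³`. -/
theorem norm_single_zero : ‖(EuclideanSpace.single (0 : Fin 3) (1 : ℝ) : V3)‖ = 1 := by simp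

/-- A unit vector is mapped to `e₀` by a Householder reflection (`Submodule.reflection_sub`). [folklore] -/
theorem exists_isometry_map_eq_single {a : V3} (ha : ‖a‖ = 1) :
    ∃ S : V3 ≃ₗᵢ[ℝ] V3, S a = EuclideanSpace.single 0 1 := by
  refine ⟨(ℝ ∙ (a - EuclideanSpace.single 0 1))ᗮ.reflection, ?_⟩
  exact Submodule.reflection_sub (by rw [ha, norm_single_zero])

/-- An orthonormal pair is mapped to `(e₀, e₁)` by the composition of two Householder reflections: the first sends
`a ↦ e₀`, the second sends the image of `b` (which is `⊥ e₀`) to `e₁` and fixes `e₀`. [folklore] -/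
theorem exists_isometry_map_pair {a b : V3} (ha : ‖a‖ = 1) (hb : ‖b‖ = 1) (hab : ⟪a, b⟫_ℝ = 0) :
    ∃ S : V3 ≃ₗᵢ[ℝ] V3, S a = EuclideanSpace.single 0 1 ∧ S b = EuclideanSpace.single 1 1 := by
  set e₀ : V3 := EuclideanSpace.single 0 1 with he₀
  set e₁ : V3 := EuclideanSpace.single 1 1 with he₁
  obtain ⟨S₁, hS₁⟩ := exists_isometry_map_eq_single ha
  set b' : V3 := S₁ b with hb'
  have hb'n : ‖b'‖ = 1 := by rw [hb', LinearIsometryEquiv.norm_map, hb]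
  have hb'e₀ : ⟪b', e₀⟫_ℝ = 0 := by
    have : e₀ = S₁ a := by rw [he₀, hS₁]
    rw [hb', this, LinearIsometryEquiv.inner_map_map, real_inner_comm, hab]
  have he₁n : ‖e₁‖ = 1 := by simp [he₁]
  have he₁e₀ : ⟪e₁, e₀⟫_ℝ = 0 := by
    rw [he₀, he₁, EuclideanSpace.inner_single_left]; simp
  set S₂ : V3 ≃ₗᵢ[ℝ] V3 := (ℝ ∙ (b' - e₁))ᗮ.reflection with hS₂
  have hS₂b : S₂ b' = e₁ := Submodule.reflection_sub (by rw [hb'n, he₁n])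
  have hmem : e₀ ∈ (ℝ ∙ (b' - e₁))ᗮ := by
    rw [Submodule.mem_orthogonal_singleton_iff_inner_right]
    rw [inner_sub_left, hb'e₀, he₁e₀, sub_zero]
  have hS₂e : S₂ e₀ = e₀ := Submodule.reflection_mem_subspace_eq_self hmem
  refine ⟨S₁.trans S₂, ?_, ?_⟩
  · rw [LinearIsometryEquiv.trans_apply, hS₁, hS₂e]
  · rw [LinearIsometryEquiv.trans_apply, ← hb', hS₂b]

/-- `⟪e_i, x⟫ = x_i`. [folklore] -/
theorem inner_single_one_left (i : Fin 3) (x : V3) : ⟪EuclideanSpace.single i (1 : ℝ), x⟫_ℝ = x.ofLp i := by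
  rw [EuclideanSpace.inner_single_left]; simp

/-! ## Registered sub-goal of the line `Sketch` (crux stmt-AtomisticToContinuum-15141) -/

/-- REGISTERED SUB-GOAL `stub_householderPair` of the line `Sketch`: an orthonormal pair of `ℝ³` is mapped to
`(e₀, e₁)` by a linear isometry (restating `exists_isometry_map_pair`). [folklore] -/
theorem stub_householderPair :
    ∀ a b : V3, ‖a‖ = 1 → ‖b‖ = 1 → ⟪a, b⟫_ℝ = 0 →
      ∃ S : V3 ≃ₗᵢ[ℝ] V3, S a = EuclideanSpace.single 0 1 ∧ S b = EuclideanSpace.single 1 1 :=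
  fun _ _ ha hb hab => exists_isometry_map_pair ha hb hab

end Summit.AtomisticToContinuum.HydrodynamicLimit.Theorems.ChaosClosesEulerEnskogTensor

end
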